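import HarnessLib.Audit.Status
import Summits.ABC.ABC.Theorems.DefiniteXiDefiniteRTControlPrimeOfTakahashi

/-! Probe (stub-critic g78, STUB-PLAN-stub_takahashi rev 78 §6(e)): read the DERIVED status of the crux `DefiniteXi.DefiniteRTControlPrime` from the landed
closer `definiteRTControlPrime_of_takahashi` via the new `HarnessLib.Audit.Status` layer (2026-09-01). `legacy` makes
`@[route_item … "crux"]` Theses defs count as nodes. Expect: `closed_mod_print` modulo `takahashi2001_thm_2_3_of_coprime`. -/

#status ABC legacy
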